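import Summits.ResolutionOfSingularities.ResolutionOfSingularities.Theorems.FrobeniusClosingSteerRsopNestedIntersection
import Summits.ResolutionOfSingularities.ResolutionOfSingularities.Theorems.FrobeniusClosingSteerChartRsopPart
import Summits.ResolutionOfSingularities.ResolutionOfSingularities.Theorems.FrobeniusClosingSteerBlowupDerivation
import Summits.ResolutionOfSingularities.ResolutionOfSingularities.Theorems.FrobeniusClosingSteerCriticalSurfaceFollowed
import Summits.ResolutionOfSingularities.ResolutionOfSingularities.Theorems.FrobeniusClosingSteerCore4SteeredRegular
import Literature.AlgebraicGeometry.Resolution.RsopPartOfRegularSequence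
import Literature.AlgebraicGeometry.Resolution.QuadraticTransforms
import HarnessLib

/-!
# Steer σ-residual, LOW half — D3a (A2): the critical-surface THREAD, part 1 — KEY LEMMA (non-units of `Λ` in the chart)

OURS (campaign res-hironaka, rung L ★L-G4, slot W4.1, crux `Steer` stmt-ResolutionOfSingularities-16345; res-L0-w41-plan-1
RULING 42 (A2) «run-threading» := res-L0-w41-stub-3 g6; contract = res-D-pv-012's `hthread`/`hinv` (STATUS 09:43:57Z / 10:01:51Z);
replaces the role of no printed item; NOT a statement of the manuscript under review [claim: Hironaka2017, status: under-review]; AI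
review is weaker than expert review). Theses-free, definition-free.

THE THREAD INVARIANT at a member `R` of the run (regular local subring of `K` dominated by `O`), with radicand `f = s²` and a local
subring `Λ ⊇ R` (the local ring at the generic point of the ORIGINAL critical surface): two derivations `δ₁, δ₂` of `R` (the
transported duals) such that (I1) the non-units of `Λ` inside `R` are exactly `𝔮 = (δ₁ f, δ₂ f)`, (I2) `(δ₁ f, δ₂ f)` is part of a
regular system of parameters, (I3) the Hessian determinant is a unit. This file:
* `exists_eq_div_pow_of_mem_chart`, `div_pow_mem_chart` — the chart ring `R[P/x] = ⋃ Pᴺ/xᴺ`;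
* `exists_transport` — along a local blowing up `R → R'` along `P ∋ x` with strict step `s = x s' + G`, `x·δ` extends to `δ'` on `R'`
  with `δ'(s'²) = δ(s²)/x` (lead-1's `BlowupDerivation`, C5′'s `derivation_transform_apply_sq`), and `δ'(s'²) ∈ 𝔪_{R'}` when the new
  stage is SINGULAR;
* `mem_span_quot_of_mem_chart` — THE KEY: an element of `R[P/x]` which is a non-unit of `Λ` lies in `(e₁/x, e₂/x)·R'` (nested
  intersection `𝔮 ∩ Pᴺ = 𝔮·Pᴺ⁻¹`, `…SteerRsopNestedIntersection`).
Part 2 (`…SteerCriticalThreadStep`) proves the step `Inv(R) ⇒ R' ≤ Λ ∧ Inv(R')`; part 3 (`…SteerCriticalThreadForms`) the chart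
presentations. [cite: Matsumura1987, Thm. 16.2] [cite: NovacoskiSpivakovsky2014, Def. 2.11] [folklore]
-/

noncomputable section

-- single-problem summit: the doubled namespace component `ResolutionOfSingularities` is forced
set_option linter.dupNamespace false

namespace Summit.ResolutionOfSingularities.ResolutionOfSingularities.Theorems.SwitchingDichotomy.CriticalThread

open IsLocalRing
open Literature.AlgebraicGeometry.Resolution
open Summit.ResolutionOfSingularities.ResolutionOfSingularities.Theorems.SwitchingDichotomy

variable {K : Type} [Field K]
/-! ## §0 Generic plumbing -/

/-- Membership in the chart ring `R[P/x]`: every element is `p / xᴺ` with `p ∈ Pᴺ`. [folklore] -/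
theorem exists_eq_div_pow_of_mem_chart (R : Subring K) (P : Ideal R) (x : K) (hxR : x ∈ R) (hxP : (⟨x, hxR⟩ : R) ∈ P)
    (hx0 : x ≠ 0) {z : K} (hz : z ∈ Subring.closure ((R : Set K) ∪ (fun y : R => (y : K) / x) '' (P : Set R))) :
    ∃ (N : ℕ) (p : R), p ∈ P ^ N ∧ z = (p : K) / x ^ N := by
  induction hz using Subring.closure_induction with
  | mem z hz =>
    rcases hz with hz | ⟨y, hy, rfl⟩
    · exact ⟨0, ⟨z, hz⟩, by simp, by simp⟩
    · exact ⟨1, y, by simpa using hy, by simp⟩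
  | zero => exact ⟨0, 0, by simp, by simp⟩
  | one => exact ⟨0, 1, by simp, by simp⟩
  | add a b _ _ ha hb =>
    obtain ⟨N, p, hp, rfl⟩ := ha
    obtain ⟨M, q, hq, rfl⟩ := hb
    refine ⟨N + M, p * ⟨x, hxR⟩ ^ M + q * ⟨x, hxR⟩ ^ N, ?_, ?_⟩
    · refine Ideal.add_mem _ ?_ ?_
      · rw [pow_add]; exact Ideal.mul_mem_mul hp (Ideal.pow_mem_pow hxP M)
      · rw [add_comm, pow_add]; exact Ideal.mul_mem_mul hq (Ideal.pow_mem_pow hxP N)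
    · have hxN : x ^ N ≠ 0 := pow_ne_zero _ hx0
      have hxM : x ^ M ≠ 0 := pow_ne_zero _ hx0
      push_cast
      field_simp
      ring
  | neg a _ ha =>
    obtain ⟨N, p, hp, rfl⟩ := ha
    exact ⟨N, -p, (P ^ N).neg_mem hp, by push_cast; ring⟩
  | mul a b _ _ ha hb =>
    obtain ⟨N, p, hp, rfl⟩ := ha
    obtain ⟨M, q, hq, rfl⟩ := hb
    refine ⟨N + M, p * q, ?_, ?_⟩
    · rw [pow_add]; exact Ideal.mul_mem_mul hp hq
    · push_cast
      rw [pow_add, div_mul_div_comm]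

/-- `Pᴹ / xᴹ ⊆ R[P/x]`. [folklore] -/
theorem div_pow_mem_chart (R : Subring K) (P : Ideal R) (x : K) :
    ∀ (M : ℕ) {m : R}, m ∈ P ^ M →
      (m : K) / x ^ M ∈ Subring.closure ((R : Set K) ∪ (fun y : R => (y : K) / x) '' (P : Set R))
  | 0, m, _ => by
    rw [pow_zero, div_one]
    exact Subring.subset_closure (Or.inl m.2)
  | M + 1, m, hm => by
    rw [pow_succ] at hm
    refine Submodule.mul_induction_on hm (fun a ha b hb => ?_) (fun a b ha hb => ?_)
    · have : ((a * b : R) : K) / x ^ (M + 1) = (a : K) / x ^ M * ((b : K) / x) := by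
        push_cast; rw [pow_succ, div_mul_div_comm]
      rw [this]
      exact Subring.mul_mem _ (div_pow_mem_chart R P x M ha) (Subring.subset_closure (Or.inr ⟨b, hb, rfl⟩))
    · have : ((a + b : R) : K) / x ^ (M + 1) = (a : K) / x ^ (M + 1) + (b : K) / x ^ (M + 1) := by
        push_cast; rw [add_div]
      rw [this]
      exact Subring.add_mem _ ha hb

/-- In the local subring `Λ ⊆ K`: a non-unit times anything in `Λ` is a non-unit; read on elements of `K`. [folklore] -/
theorem not_isUnit_mul_of_not_isUnit {Λ : Subring K} [IsLocalRing Λ] {a b : K} (ha : a ∈ Λ) (hb : b ∈ Λ)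
    (hna : ¬ IsUnit (⟨a, ha⟩ : Λ)) : ¬ IsUnit (⟨a * b, Λ.mul_mem ha hb⟩ : Λ) := by
  rw [← mem_nonunits_iff, ← IsLocalRing.mem_maximalIdeal] at hna ⊢
  have : (⟨a * b, Λ.mul_mem ha hb⟩ : Λ) = ⟨a, ha⟩ * ⟨b, hb⟩ := rfl
  rw [this]
  exact Ideal.mul_mem_right _ _ hna

/-- A unit of the subring `Λ ⊆ K` has its inverse in `Λ`. [folklore] -/
theorem inv_mem_of_isUnit {Λ : Subring K} {a : K} (ha : a ∈ Λ) (hu : IsUnit (⟨a, ha⟩ : Λ)) : a⁻¹ ∈ Λ :=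
  ((isUnit_subring_iff_inv_mem _).mp hu).2


/-! ## §1 Facts read off the normal form `R' = C_{𝔪_O ∩ C}` of the local blowing up -/

section NormalForm

variable {O : ValuationSubring K} {C R' : Subring K}

/-- Domination of the local blowing up by `O`: `a ∈ 𝔪_{R'} ↔ v(a) < 1`. [folklore] -/
theorem mem_maximalIdeal_iff_of_eq [IsLocalRing R'] (hCO : C ≤ O.toSubring) (h : R' = locAtCentre C O) (a : R') :
    a ∈ maximalIdeal R' ↔ O.valuation (a : K) < 1 := by
  subst h; exact mem_maximalIdeal_locAtCentre_iff hCO a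

/-- The chart lies in the local blowing up. [folklore] -/
theorem chart_le_of_eq (h : R' = locAtCentre C O) : C ≤ R' := by
  rw [h]; exact le_locAtCentre C O

/-- Elements of the chart of value `1` are units of the local blowing up (inverse form). [folklore] -/
theorem inv_mem_of_eq (h : R' = locAtCentre C O) {w : K} (hw : w ∈ C) (hv : O.valuation w = 1) : w⁻¹ ∈ R' := by
  rw [h]; exact inv_mem_locAtCentre (le_locAtCentre C O hw) hv

/-- Elements of the local blowing up are fractions `y / w`, `y, w` in the chart, `v(w) = 1`. [folklore] -/
theorem exists_div_of_eq (h : R' = locAtCentre C O) {z : K} (hz : z ∈ R') :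
    ∃ y ∈ C, ∃ w ∈ C, O.valuation w = 1 ∧ z = y / w := by
  rw [h] at hz; exact hz

end NormalForm

/-! ## §2 The transported derivation and the transform law -/

/-- **Transport and transform law** (lead-1's `BlowupDerivation.exists_derivation_smul_localBlowupAlong` + C5′'s
`CriticalSurface.derivation_transform_apply_sq`): along a local blowing up `R → R'` along `P ∋ x` with strict step
`s = x s' + G`, the derivation `x·δ` extends to a derivation `δ'` of `R'` with `δ'(s'²) = δ(s²)/x`; if the new stage is
SINGULAR (`s'² ≡ γ² (mod 𝔪'²)`) then `δ'(s'²) ∈ 𝔪_{R'}`. [folklore] -/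
theorem exists_transport [CharP K 2] {O : ValuationSubring K} {R R' : Subring K} [IsLocalRing R'] {P : Ideal R}
    (hbl : IsLocalBlowupAlong O R P R') {x : K} (hxR : x ∈ R) (hxP : (⟨x, hxR⟩ : R) ∈ P) (hx0 : x ≠ 0)
    {s s' G : K} (hs : s ^ 2 ∈ R) (hs' : s' ^ 2 ∈ R') (hG : G ∈ R) (hstep : s = x * s' + G)
    (hsing : ∃ γ : R', (⟨s' ^ 2, hs'⟩ : R') - γ ^ 2 ∈ maximalIdeal R' ^ 2) (δ : Derivation ℤ R R) :
    ∃ δ' : Derivation ℤ R' R',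
      (∀ a : R, ((δ' ⟨(a : K), hbl.isLocalBlowup.le a.2⟩ : R') : K) = x * ((δ a : R) : K)) ∧
      ((δ' ⟨s' ^ 2, hs'⟩ : R') : K) = ((δ ⟨s ^ 2, hs⟩ : R) : K) / x ∧
      δ' ⟨s' ^ 2, hs'⟩ ∈ maximalIdeal R' := by
  haveI : Fact (2 : ℕ).Prime := ⟨Nat.prime_two⟩
  haveI : CharP R' 2 := inferInstance
  have hle : R ≤ R' := hbl.isLocalBlowup.le
  obtain ⟨δ', hδ'⟩ := BlowupDerivation.exists_derivation_smul_localBlowupAlong O R R' P hbl ⟨x, hxR⟩ hxP δ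
  have hδ'K : ∀ a : R, ((δ' ⟨(a : K), hle a.2⟩ : R') : K) = x * ((δ a : R) : K) := fun a => by
    have e : Subring.inclusion hbl.isLocalBlowup.le a = ⟨(a : K), hle a.2⟩ := rfl
    have h := congrArg (fun z : R' => (z : K)) (hδ' a)
    rw [e] at h
    simpa using h
  refine ⟨δ', hδ'K, CriticalSurface.derivation_transform_apply_sq R R' hle x hxR hx0 s s' G hs hs' hG hstep δ δ' hδ'K, ?_⟩
  obtain ⟨γ, hγ⟩ := hsing
  have h := CriticalSurface.derivation_apply_mem_of_mem_sq δ' _ hγ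
  rwa [map_sub, CriticalSurface.derivation_apply_sq, sub_zero] at h

/-! ## §3 The key lemma: non-units of `Λ` inside the chart -/

section Key

variable {O : ValuationSubring K} {R R' Λ : Subring K} [IsLocalRing R] [IsLocalRing Λ]

/-- **Non-units of `Λ` in the chart `R[P/x]` lie in `(e₁/x, e₂/x)·R'`.** Data: `R ≤ Λ` local subrings, `e₁, e₂ ∈ R` with
«non-units of `Λ` in `R` lie in `(e₁, e₂)`», a part `y` of a regular system of parameters of `R` generating `P` whose first two
members generate `(e₁, e₂)`, `x ∈ P` nonzero with `x⁻¹ ∈ Λ`, `R[P/x] ⊆ R'`, and `E_j ∈ R'` with `E_j = e_j / x`. For `z ∈ R[P/x]`: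
`z = p/xᴺ` with `p = z·xᴺ ∈ (e₁, e₂) ∩ Pᴺ = (e₁, e₂)·Pᴺ⁻¹` (`RsopNested.span_inf_pow_succ_eq_mul_pow`), so
`z = E₁·(m₁/xᴺ⁻¹) + E₂·(m₂/xᴺ⁻¹)`. [cite: Matsumura1987, Thm. 16.2] -/
theorem mem_span_quot_of_mem_chart (hRΛ : R ≤ Λ) {e₁ e₂ : R}
    (hq : ∀ r : R, ¬ IsUnit (⟨(r : K), hRΛ r.2⟩ : Λ) → r ∈ Ideal.span {e₁, e₂})
    {P : Ideal R} {r : ℕ} {y : Fin (2 + r) → R} (hy : IsRsopPart y) (hyP : Ideal.span (Set.range y) = P)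
    (hy0 : y (Fin.castAdd r 0) = e₁) (hy1 : y (Fin.castAdd r 1) = e₂)
    {x : K} (hxR : x ∈ R) (hxP : (⟨x, hxR⟩ : R) ∈ P) (hx0 : x ≠ 0)
    (hCR' : Subring.closure ((R : Set K) ∪ (fun w : R => (w : K) / x) '' (P : Set R)) ≤ R')
    {E₁ E₂ : R'} (hE₁ : (E₁ : K) = (e₁ : K) / x) (hE₂ : (E₂ : K) = (e₂ : K) / x)
    {z : K} (hz : z ∈ Subring.closure ((R : Set K) ∪ (fun w : R => (w : K) / x) '' (P : Set R)))
    (hzΛ : z ∈ Λ) (hzu : ¬ IsUnit (⟨z, hzΛ⟩ : Λ)) :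
    (⟨z, hCR' hz⟩ : R') ∈ Ideal.span {E₁, E₂} := by
  have hle : R ≤ R' := fun w hw => hCR' (Subring.subset_closure (Or.inl hw))
  obtain ⟨N, p, hpN, hzp⟩ := exists_eq_div_pow_of_mem_chart R P x hxR hxP hx0 hz
  -- `p = z · xᴺ` is a non-unit of `Λ`, hence in `(e₁, e₂)`
  have hxNΛ : x ^ N ∈ Λ := Λ.pow_mem (hRΛ hxR) N
  have hpz : (p : K) = z * x ^ N := by
    rw [hzp, div_mul_cancel₀ _ (pow_ne_zero _ hx0)]
  have hpu : ¬ IsUnit (⟨(p : K), hRΛ p.2⟩ : Λ) := by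
    have h := not_isUnit_mul_of_not_isUnit hzΛ hxNΛ hzu
    have heq : (⟨z * x ^ N, Λ.mul_mem hzΛ hxNΛ⟩ : Λ) = ⟨(p : K), hRΛ p.2⟩ := Subtype.ext hpz.symm
    rwa [heq] at h
  have hpq : p ∈ Ideal.span {e₁, e₂} := hq p hpu
  -- the first block of `y` generates `(e₁, e₂)`
  have hyq : Ideal.span (Set.range (y ∘ Fin.castAdd r)) = Ideal.span {e₁, e₂} := by
    have : y ∘ Fin.castAdd r = ![e₁, e₂] := by
      funext k; fin_cases k
      · exact hy0
      · exact hy1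
    rw [this, CriticalSurface.span_range_pair]
  cases N with
  | zero =>
    -- `z = p ∈ (e₁, e₂)`: `z = (a x)·E₁ + (b x)·E₂`
    obtain ⟨a, b, hab⟩ := Ideal.mem_span_pair.mp hpq
    rw [pow_zero, div_one] at hzp
    have heq : (⟨z, hCR' hz⟩ : R') = ⟨(a : K) * x, R'.mul_mem (hle a.2) (hle hxR)⟩ * E₁ +
        ⟨(b : K) * x, R'.mul_mem (hle b.2) (hle hxR)⟩ * E₂ := by
      apply Subtype.ext
      push_cast
      rw [hE₁, hE₂, hzp, ← hab]
      push_cast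
      field_simp
    rw [heq]
    exact Ideal.add_mem _ (Ideal.mul_mem_left _ _ (Ideal.subset_span (by simp)))
      (Ideal.mul_mem_left _ _ (Ideal.subset_span (by simp)))
  | succ M =>
    -- `p ∈ (e₁, e₂) ∩ P^{M+1} = (e₁, e₂)·P^M`
    have hpI : p ∈ Ideal.span {e₁, e₂} * P ^ M := by
      have h := RsopNested.span_inf_pow_succ_eq_mul_pow hy M
      rw [hyq, hyP] at h
      rw [← h]
      exact ⟨hpq, hpN⟩
    rw [Ideal.span_insert, Ideal.sup_mul] at hpI
    obtain ⟨p₁, hp₁, p₂, hp₂, hp12⟩ := Submodule.mem_sup.mp hpI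
    obtain ⟨m₁, hm₁, rfl⟩ := Ideal.mem_span_singleton_mul.mp hp₁
    obtain ⟨m₂, hm₂, rfl⟩ := Ideal.mem_span_singleton_mul.mp hp₂
    have hm₁C := hCR' (div_pow_mem_chart R P x M hm₁)
    have hm₂C := hCR' (div_pow_mem_chart R P x M hm₂)
    have heq : (⟨z, hCR' hz⟩ : R') = E₁ * ⟨(m₁ : K) / x ^ M, hm₁C⟩ + E₂ * ⟨(m₂ : K) / x ^ M, hm₂C⟩ := by
      apply Subtype.ext
      push_cast
      rw [hE₁, hE₂, hzp, ← hp12]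
      push_cast
      have hxM : x ^ M ≠ 0 := pow_ne_zero _ hx0
      field_simp
      ring
    rw [heq]
    exact Ideal.add_mem _ (Ideal.mul_mem_right _ _ (Ideal.subset_span (by simp)))
      (Ideal.mul_mem_right _ _ (Ideal.subset_span (by simp)))

end Key

end Summit.ResolutionOfSingularities.ResolutionOfSingularities.Theorems.SwitchingDichotomy.CriticalThread

end
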